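import Summits.NavierStokesRegularity.NavierStokesRegularity.Theses.CoriolisHead
import Summits.NavierStokesRegularity.NavierStokesRegularity.Theorems.CoriolisHeadNoCoRotatingCoreSpinVorticity
import Summits.NavierStokesRegularity.NavierStokesRegularity.Theorems.CoriolisHeadNoCoRotatingCoreEnergyLiouville
import Summits.NavierStokesRegularity.NavierStokesRegularity.Theorems.CoriolisHeadNoCoRotatingCoreMeanSquareGradient
import Summits.NavierStokesRegularity.NavierStokesRegularity.Theorems.CoriolisHeadCounterRotatingLiouville
import HarnessLib

/-!
# Route CoriolisHead · crux `NoCoRotatingCore` (stmt-NavierStokesRegularity-22676) —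
# RUNG: no co-rotating core for rotated profiles WITHOUT AXIAL VELOCITY

Support file (`--supports stmt-NavierStokesRegularity-22676`; theorems only, no definitions, no named
facts): a DECIDED SUB-CLASS (bc5 rung / T3 witness) of the open crux

  `NoCoRotatingCore`: every smooth bounded solution `(U, P)` of the rotated Leray profile system
  `−νΔU + aU + a DU[y] + (BU − DU[By]) + DU[U] + ∇P = 0`, `div U = 0` (`ν, a > 0`, `B` skew) has
  signed Coriolis defect `tr(B∘DU(y)) = Σₗ (B ∂ₗU(y))ₗ ≥ 0` at every point.

THE CLASS.  Write `Bx = β × x` (`β = ((B e₁)₂, (B e₂)₀, (B e₀)₁)` the axial vector of the frame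
rotation).  A profile has NO AXIAL VELOCITY if `⟪β, U(y)⟫ = 0` for all `y` (the velocity is everywhere
orthogonal to the rotation axis; this contains all planar / 2½-dimensional rotated profiles with
vertical frame axis, and for `B = 0` it is every profile).

THE THEOREM (`noCoRotatingCore_of_noAxialVelocity`, binders = those of the crux plus the class
hypothesis): on this class the Coriolis defect VANISHES IDENTICALLY (`sum_clm_fderiv_apply_eq_zero_of_
noAxialVelocity`), in particular it is `≥ 0`; and by the proved crux `CounterRotatingLiouville`
(stmt-22677, `counterRotatingLiouville_proof`) every such profile is constant
(`exists_eq_const_of_noAxialVelocity`) — bounded rotated-profile Liouville `X` holds on the class.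

PROOF = the skeleton's mechanism with ZERO STRAIN FEED.  By the lead's landed stub
`stub_spinVorticityIdentity` the spin vorticity `ω_β = −tr(B∘DU) = ⟪β, curl U⟫` solves
`νΔω_β − Dω_β[U − By + ay] = 2a ω_β − ⟪β, DU[curl U]⟫`; with no axial velocity the feed
`⟪β, DU(y)[v]⟫ = D⟪β, U⟫(y)[v]` vanishes for every `v` (`inner_fderiv_apply_eq_zero_of_inner_eq_zero`),
so `L ω_β = 2a ω_β` exactly — the co-rotating core is not strain-fed.  The Gaussian-weighted energy
Liouville theorem `eq_zero_of_driftOp_eq_two_mul` (`CoriolisHeadNoCoRotatingCoreEnergyLiouville`; it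
needs only the mean-square growth `∫_{B(0,R)} ω_β² ≤ K(1+R)^m`, supplied by
`CoriolisHeadNoCoRotatingCoreMeanSquareGradient` from Tsai's (3.1)) gives `ω_β ≡ 0`.

HONEST FRAMING.  This is a decided special case, not the crux: `NoCoRotatingCore` (≡ bounded
rotated-profile Liouville, Pineau–Vicol Conj. 1.1 strengthened; see
`CoriolisHeadNoCoRotatingCoreReduction`) stays OPEN — its difficulty is exactly the strain feed
`⟪β, DU[ω]⟫` that vanishes here — and Navier–Stokes regularity is NOT proved by any of this.  The
class sits inside the regime where regularity is classical (planar-type flows), so as a T3 witness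
it is THIN; what it exercises is the new half of the lever (spin-vorticity damping `2a ω_β`), which
the `B = 0` rung of `CounterRotatingLiouville` does not.

References: B. Pineau, V. Vicol, arXiv:2607.09619, (1.8) and Conj. 1.1 [PineauVicol2026];
T.-P. Tsai, ARMA 143 (1998) 29–51, Thm 1, Lemma 3.1 [Tsai1998]; A. J. Majda, A. L. Bertozzi,
*Vorticity and Incompressible Flow* (CUP 2002), §2.1 (2.5) (vorticity equation) [MajdaBertozziCUP2002].
-/

noncomputable section

-- the summit and its single sub-problem share the name (CONVENTIONS §1), as in every Theorems file
set_option linter.dupNamespace false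

open MeasureTheory Set Function Filter Topology InnerProductSpace Metric
open scoped RealInnerProductSpace Laplacian ContDiff BigOperators
open Literature.Analysis.FluidPDE
open Summit.NavierStokesRegularity.NavierStokesRegularity.Theses

namespace Summit.NavierStokesRegularity.NavierStokesRegularity.Theorems.CoriolisHead

section NoAxialVelocity

variable {ν a : ℝ} {B : EuclideanSpace ℝ (Fin 3) →L[ℝ] EuclideanSpace ℝ (Fin 3)}
  {U : EuclideanSpace ℝ (Fin 3) → EuclideanSpace ℝ (Fin 3)} {P : EuclideanSpace ℝ (Fin 3) → ℝ}

/-- If a differentiable field has no component along a fixed vector `β` (`⟪β, U⟫ ≡ 0`), neither has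
any of its directional derivatives: `⟪β, DU(y)[v]⟫ = D⟪β, U⟫(y)[v] = 0`. [folklore] -/
theorem inner_fderiv_apply_eq_zero_of_inner_eq_zero {β : EuclideanSpace ℝ (Fin 3)}
    (hU : Differentiable ℝ U) (hβU : ∀ y, ⟪β, U y⟫ = 0) (y v : EuclideanSpace ℝ (Fin 3)) :
    ⟪β, fderiv ℝ U y v⟫ = 0 := by
  have hg : (fun z => ⟪β, U z⟫) = fun _ => (0 : ℝ) := funext hβU
  have hd : HasFDerivAt (fun z => ⟪β, U z⟫) ((innerSL ℝ β).comp (fderiv ℝ U y)) y :=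
    (innerSL ℝ β).hasFDerivAt.comp y (hU y).hasFDerivAt
  have h1 : fderiv ℝ (fun z => ⟪β, U z⟫) y v = ⟪β, fderiv ℝ U y v⟫ := by
    rw [hd.fderiv]
    rfl
  rw [← h1, hg, fderiv_const_apply]
  rfl

/-- **Zero strain feed ⇒ exact damping.** For a smooth solution of the rotated profile system
WITHOUT AXIAL VELOCITY (`⟪β, U⟫ ≡ 0`, `β` the axial vector of the skew `B`), the spin vorticity
`ω_β = −Σₗ (B ∂ₗU)ₗ` solves `νΔω_β − Dω_β[U − By + ay] = 2a ω_β` (the strain feed `⟪β, DU[curl U]⟫` of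
`stub_spinVorticityIdentity` vanishes). [cite: MajdaBertozziCUP2002, §2.1 eq. (2.5)] -/
theorem driftOp_spinVorticity_eq_of_noAxialVelocity (hU : ContDiff ℝ (⊤ : ℕ∞) U)
    (hP : ContDiff ℝ 2 P) (hB : ∀ x, ⟪B x, x⟫ = 0) (hdiv : VectorCalculus.IsDivFree U)
    (heq : ∀ y, -(ν • Laplacian.laplacian U y) + a • U y + a • fderiv ℝ U y y
      + (B (U y) - fderiv ℝ U y (B y)) + convect U U y + gradient P y = 0)
    (hax : ∀ y, ⟪(WithLp.toLp 2 ![(B (EuclideanSpace.single 1 1)) 2, (B (EuclideanSpace.single 2 1)) 0,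
        (B (EuclideanSpace.single 0 1)) 1] : EuclideanSpace ℝ (Fin 3)), U y⟫ = 0)
    (y : EuclideanSpace ℝ (Fin 3)) :
    driftOp ν a (fun z => U z - B z)
        (fun z => -(∑ l, (B (fderiv ℝ U z (EuclideanSpace.single l 1))) l)) y
      = 2 * a * ((fun z => -(∑ l, (B (fderiv ℝ U z (EuclideanSpace.single l 1))) l)) y) := by
  rw [stub_spinVorticityIdentity ν a B U P hU hP hB hdiv heq y,
    inner_fderiv_apply_eq_zero_of_inner_eq_zero (hU.differentiable (by simp)) hax y (curl U y),
    sub_zero]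

/-- The spin vorticity `ω_β = −Σₗ (B ∂ₗU)ₗ` of a smooth field is `C²`. [folklore] -/
theorem contDiff_spinVorticity (hU : ContDiff ℝ (⊤ : ℕ∞) U) :
    ContDiff ℝ 2 (fun z => -(∑ l, (B (fderiv ℝ U z (EuclideanSpace.single l 1))) l)) := by
  have hDU : ContDiff ℝ 2 (fderiv ℝ U) := hU.fderiv_right (m := 2) (by norm_cast)
  refine ContDiff.neg (ContDiff.sum fun l _ => ?_)
  have h1 : ContDiff ℝ 2 fun z => B (fderiv ℝ U z (EuclideanSpace.single l 1)) :=
    B.contDiff.comp (hDU.clm_apply contDiff_const)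
  exact (EuclideanSpace.proj l).contDiff.comp h1

/-- **No spin vorticity without axial velocity.** For a smooth BOUNDED solution of the rotated Leray
profile system (`ν, a > 0`, `B` skew) with `⟪β, U⟫ ≡ 0`, the spin vorticity vanishes identically:
`ω_β = −tr(B∘DU) ≡ 0` (zero strain feed, then the Gaussian-weighted energy Liouville theorem with the
mean-square growth from Tsai's (3.1)). [cite: Tsai1998, Lemma 3.1 (3.1) (p. 37)] -/
theorem spinVorticity_eq_zero_of_noAxialVelocity (hν : 0 < ν) (ha : 0 < a)
    (hU : ContDiff ℝ (⊤ : ℕ∞) U) (hP : ContDiff ℝ 2 P) (hB : ∀ x, ⟪B x, x⟫ = 0)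
    (hdiv : VectorCalculus.IsDivFree U)
    (heq : ∀ y, -(ν • Laplacian.laplacian U y) + a • U y + a • fderiv ℝ U y y
      + (B (U y) - fderiv ℝ U y (B y)) + convect U U y + gradient P y = 0)
    (hbdd : ∃ M : ℝ, ∀ y, ‖U y‖ ≤ M)
    (hax : ∀ y, ⟪(WithLp.toLp 2 ![(B (EuclideanSpace.single 1 1)) 2, (B (EuclideanSpace.single 2 1)) 0,
        (B (EuclideanSpace.single 0 1)) 1] : EuclideanSpace ℝ (Fin 3)), U y⟫ = 0)
    (y : EuclideanSpace ℝ (Fin 3)) :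
    -(∑ l, (B (fderiv ℝ U y (EuclideanSpace.single l 1))) l) = 0 := by
  have hU1 : ContDiff ℝ 1 U := hU.of_le (by norm_cast)
  exact eq_zero_of_driftOp_eq_two_mul hν ha hB hU1 hdiv hbdd (contDiff_spinVorticity hU)
    (driftOp_spinVorticity_eq_of_noAxialVelocity hU hP hB hdiv heq hax)
    (exists_integral_ball_sq_spinVorticity_le_of_rotated hν ha hU hP hB hdiv heq hbdd) y

/-- **The Coriolis defect of a no-axial-velocity profile vanishes identically**:
`tr(B∘DU(y)) = Σₗ (B ∂ₗU(y))ₗ = 0` for every `y`. [cite: PineauVicol2026, (1.8) (p. 3)] -/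
theorem sum_clm_fderiv_apply_eq_zero_of_noAxialVelocity (hν : 0 < ν) (ha : 0 < a)
    (hU : ContDiff ℝ (⊤ : ℕ∞) U) (hP : ContDiff ℝ 2 P) (hB : ∀ x, ⟪B x, x⟫ = 0)
    (hdiv : VectorCalculus.IsDivFree U)
    (heq : ∀ y, -(ν • Laplacian.laplacian U y) + a • U y + a • fderiv ℝ U y y
      + (B (U y) - fderiv ℝ U y (B y)) + convect U U y + gradient P y = 0)
    (hbdd : ∃ M : ℝ, ∀ y, ‖U y‖ ≤ M)
    (hax : ∀ y, ⟪(WithLp.toLp 2 ![(B (EuclideanSpace.single 1 1)) 2, (B (EuclideanSpace.single 2 1)) 0,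
        (B (EuclideanSpace.single 0 1)) 1] : EuclideanSpace ℝ (Fin 3)), U y⟫ = 0)
    (y : EuclideanSpace ℝ (Fin 3)) :
    ∑ l, (B (fderiv ℝ U y (EuclideanSpace.single l 1))) l = 0 :=
  neg_eq_zero.1 (spinVorticity_eq_zero_of_noAxialVelocity hν ha hU hP hB hdiv heq hbdd hax y)

end NoAxialVelocity

/-! ### The rung, in the binders of the crux -/

/-- **RUNG of `NoCoRotatingCore` (bc5 witness): no co-rotating core WITHOUT AXIAL VELOCITY.**
The crux `CoriolisHead.NoCoRotatingCore` restricted to the class `⟪β, U⟫ ≡ 0` (`β` the axial vector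
of the skew frame rotation `B`, `Bx = β × x`): for every `ν, a > 0`, skew `B`, and every smooth bounded
divergence-free solution `(U, P)` of the rotated Leray profile system whose velocity is everywhere
orthogonal to the rotation axis, the Coriolis defect is signed — indeed zero — at every point:
`0 ≤ Σₗ (B ∂ₗU(y))ₗ`.  Same binders as the crux plus the one class hypothesis; the crux itself
(all bounded rotated profiles) remains open. [cite: PineauVicol2026, Conjecture 1.1 and (1.8) (p. 3)] -/
theorem noCoRotatingCore_of_noAxialVelocity : ∀ (ν a : ℝ), 0 < ν → 0 < a →
    ∀ (B : EuclideanSpace ℝ (Fin 3) →L[ℝ] EuclideanSpace ℝ (Fin 3))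
      (U : EuclideanSpace ℝ (Fin 3) → EuclideanSpace ℝ (Fin 3)) (P : EuclideanSpace ℝ (Fin 3) → ℝ),
      ContDiff ℝ (⊤ : ℕ∞) U → ContDiff ℝ 2 P → (∀ x, inner ℝ (B x) x = 0) →
      Literature.Analysis.FluidPDE.VectorCalculus.IsDivFree U →
      (∀ y, -(ν • Laplacian.laplacian U y) + a • U y + a • fderiv ℝ U y y + (B (U y) - fderiv ℝ U y (B y))
        + Literature.Analysis.FluidPDE.convect U U y + gradient P y = 0) →
      (∃ M : ℝ, ∀ y, ‖U y‖ ≤ M) →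
      (∀ y, inner ℝ (WithLp.toLp 2 ![(B (EuclideanSpace.single 1 1)) 2, (B (EuclideanSpace.single 2 1)) 0,
        (B (EuclideanSpace.single 0 1)) 1] : EuclideanSpace ℝ (Fin 3)) (U y) = 0) →
      ∀ y, 0 ≤ ∑ l, (B (fderiv ℝ U y (EuclideanSpace.single l 1))) l := by
  intro ν a hν ha B U P hU hP hB hdiv heq hbdd hax y
  rw [sum_clm_fderiv_apply_eq_zero_of_noAxialVelocity hν ha hU hP hB hdiv heq hbdd hax y]

/-- **Bounded rotated profiles without axial velocity are constant** (bounded rotated-profile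
Liouville `X` on the class): combine the rung with the proved crux `CounterRotatingLiouville`
(stmt-NavierStokesRegularity-22677, `counterRotatingLiouville_proof`). [cite: Tsai1998, Thm 1 (the case B = 0)] -/
theorem exists_eq_const_of_noAxialVelocity {ν a : ℝ} (hν : 0 < ν) (ha : 0 < a)
    {B : EuclideanSpace ℝ (Fin 3) →L[ℝ] EuclideanSpace ℝ (Fin 3)}
    {U : EuclideanSpace ℝ (Fin 3) → EuclideanSpace ℝ (Fin 3)} {P : EuclideanSpace ℝ (Fin 3) → ℝ}
    (hU : ContDiff ℝ (⊤ : ℕ∞) U) (hP : ContDiff ℝ 2 P) (hB : ∀ x, ⟪B x, x⟫ = 0)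
    (hdiv : VectorCalculus.IsDivFree U)
    (heq : ∀ y, -(ν • Laplacian.laplacian U y) + a • U y + a • fderiv ℝ U y y
      + (B (U y) - fderiv ℝ U y (B y)) + convect U U y + gradient P y = 0)
    (hbdd : ∃ M : ℝ, ∀ y, ‖U y‖ ≤ M)
    (hax : ∀ y, ⟪(WithLp.toLp 2 ![(B (EuclideanSpace.single 1 1)) 2, (B (EuclideanSpace.single 2 1)) 0,
        (B (EuclideanSpace.single 0 1)) 1] : EuclideanSpace ℝ (Fin 3)), U y⟫ = 0) :
    ∃ b : EuclideanSpace ℝ (Fin 3), ∀ y, U y = b :=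
  counterRotatingLiouville_proof ν a hν ha B U P hU hP hB hdiv heq hbdd
    (noCoRotatingCore_of_noAxialVelocity ν a hν ha B U P hU hP hB hdiv heq hbdd hax)

/-- **On the class the whole velocity gradient vanishes**: a smooth bounded rotated profile without
axial velocity has `DU ≡ 0` (it is constant), so every Coriolis defect term `(B ∂ₗU)ₗ` is zero — the
no-axial-velocity profiles are settled for any future proof of `NoCoRotatingCore`. [cite: PineauVicol2026, Conjecture 1.1 (p. 3)] -/
theorem fderiv_eq_zero_of_noAxialVelocity {ν a : ℝ} (hν : 0 < ν) (ha : 0 < a)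
    {B : EuclideanSpace ℝ (Fin 3) →L[ℝ] EuclideanSpace ℝ (Fin 3)}
    {U : EuclideanSpace ℝ (Fin 3) → EuclideanSpace ℝ (Fin 3)} {P : EuclideanSpace ℝ (Fin 3) → ℝ}
    (hU : ContDiff ℝ (⊤ : ℕ∞) U) (hP : ContDiff ℝ 2 P) (hB : ∀ x, ⟪B x, x⟫ = 0)
    (hdiv : VectorCalculus.IsDivFree U)
    (heq : ∀ y, -(ν • Laplacian.laplacian U y) + a • U y + a • fderiv ℝ U y y
      + (B (U y) - fderiv ℝ U y (B y)) + convect U U y + gradient P y = 0)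
    (hbdd : ∃ M : ℝ, ∀ y, ‖U y‖ ≤ M)
    (hax : ∀ y, ⟪(WithLp.toLp 2 ![(B (EuclideanSpace.single 1 1)) 2, (B (EuclideanSpace.single 2 1)) 0,
        (B (EuclideanSpace.single 0 1)) 1] : EuclideanSpace ℝ (Fin 3)), U y⟫ = 0) :
    ∀ y, fderiv ℝ U y = 0 := by
  obtain ⟨b, hb⟩ := exists_eq_const_of_noAxialVelocity hν ha hU hP hB hdiv heq hbdd hax
  intro y
  have hUc : U = fun _ => b := funext hb
  rw [hUc]
  exact fderiv_const_apply b

/-! ### Rigid axial motion: constant axial velocity -/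

/-- **RUNG, widened: no co-rotating core under RIGID AXIAL MOTION.**  The class hypothesis of
`noCoRotatingCore_of_noAxialVelocity` can be relaxed from `⟪β, U⟫ ≡ 0` to `⟪β, U⟫ ≡ c` CONSTANT
(uniform translation along the rotation axis; now every constant profile belongs to the class): the
strain feed `⟪β, DU(y)[v]⟫ = D⟪β, U⟫(y)[v]` still vanishes, so the spin vorticity solves the
zero-feed equation and vanishes by the energy Liouville theorem, and the Coriolis defect is `≥ 0`
(indeed `= 0`) everywhere.  Binders = those of the crux plus `∃ c, ∀ y, ⟪β, U y⟫ = c`; the crux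
itself remains open. [cite: PineauVicol2026, Conjecture 1.1 and (1.8) (p. 3)] -/
theorem noCoRotatingCore_of_constAxialVelocity : ∀ (ν a : ℝ), 0 < ν → 0 < a →
    ∀ (B : EuclideanSpace ℝ (Fin 3) →L[ℝ] EuclideanSpace ℝ (Fin 3))
      (U : EuclideanSpace ℝ (Fin 3) → EuclideanSpace ℝ (Fin 3)) (P : EuclideanSpace ℝ (Fin 3) → ℝ),
      ContDiff ℝ (⊤ : ℕ∞) U → ContDiff ℝ 2 P → (∀ x, inner ℝ (B x) x = 0) →
      Literature.Analysis.FluidPDE.VectorCalculus.IsDivFree U →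
      (∀ y, -(ν • Laplacian.laplacian U y) + a • U y + a • fderiv ℝ U y y + (B (U y) - fderiv ℝ U y (B y))
        + Literature.Analysis.FluidPDE.convect U U y + gradient P y = 0) →
      (∃ M : ℝ, ∀ y, ‖U y‖ ≤ M) →
      (∃ c : ℝ, ∀ y, inner ℝ (WithLp.toLp 2 ![(B (EuclideanSpace.single 1 1)) 2,
        (B (EuclideanSpace.single 2 1)) 0, (B (EuclideanSpace.single 0 1)) 1] : EuclideanSpace ℝ (Fin 3))
        (U y) = c) →
      ∀ y, 0 ≤ ∑ l, (B (fderiv ℝ U y (EuclideanSpace.single l 1))) l := by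
  intro ν a hν ha B U P hU hP hB hdiv heq hbdd hax y
  obtain ⟨c, hc⟩ := hax
  set β : EuclideanSpace ℝ (Fin 3) := WithLp.toLp 2 ![(B (EuclideanSpace.single 1 1)) 2,
    (B (EuclideanSpace.single 2 1)) 0, (B (EuclideanSpace.single 0 1)) 1] with hβ
  have hU1 : ContDiff ℝ 1 U := hU.of_le (by norm_cast)
  have hUd : Differentiable ℝ U := hU1.differentiable one_ne_zero
  -- the feed vanishes: `D⟪β, U⟫ = 0` for `⟪β, U⟫ ≡ c`
  have hfeed : ∀ z v, ⟪β, fderiv ℝ U z v⟫ = 0 := fun z v => by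
    have hg : (fun w => ⟪β, U w⟫) = fun _ => c := funext hc
    have hd : HasFDerivAt (fun w => ⟪β, U w⟫) ((innerSL ℝ β).comp (fderiv ℝ U z)) z :=
      (innerSL ℝ β).hasFDerivAt.comp z (hUd z).hasFDerivAt
    have h1 : fderiv ℝ (fun w => ⟪β, U w⟫) z v = ⟪β, fderiv ℝ U z v⟫ := by
      rw [hd.fderiv]
      rfl
    rw [← h1, hg, fderiv_const_apply]
    rfl
  -- zero-feed equation for the spin vorticity, then the energy Liouville theorem
  have hdrift : ∀ z, driftOp ν a (fun w => U w - B w)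
      (fun w => -(∑ l, (B (fderiv ℝ U w (EuclideanSpace.single l 1))) l)) z
      = 2 * a * ((fun w => -(∑ l, (B (fderiv ℝ U w (EuclideanSpace.single l 1))) l)) z) := fun z => by
    rw [stub_spinVorticityIdentity ν a B U P hU hP hB hdiv heq z, hfeed z (curl U z), sub_zero]
  have hzero := eq_zero_of_driftOp_eq_two_mul hν ha hB hU1 hdiv hbdd (contDiff_spinVorticity hU)
    hdrift (exists_integral_ball_sq_spinVorticity_le_of_rotated hν ha hU hP hB hdiv heq hbdd) y
  rw [neg_eq_zero] at hzero
  rw [hzero]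

end Summit.NavierStokesRegularity.NavierStokesRegularity.Theorems.CoriolisHead

end
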